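import Summits.QuantumFields.YangMills.Theorems.BalabanUVNodesK0Stub2OfPrintedZdCub
import Literature.MathematicalPhysics.QuantumFieldTheory.Balaban1983to89.B8Prop6CubeMemberOfThm33Gamma

/-!
# K0⁷ STUB 2 (`stub_prop6MemberB8At13`, skeleton V18) FROM THE EDITION-γ SOCKET FAMILIES AT NODE 00's CUBE MEMBERS — the K0 end of the cube road «D2γ»:
# V18's registered stub-2 BODY from Proposition 5's two existence sockets and the all-levels four-line collar socket over print's split class `cubeLamBP'`
# at every cube of every member of `ZdIdx 4 F.L` (𝔸 = M₂(ℂ))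

Cell `pub-ymgap`, width seat `pub-ymgap-k0-s2-w1` (g0; director-ym №197 ∕ HUMAN RULING D-0149; plan W-SEAT-START-LIST §k0-s2; dag-n05-e g9 HAND-OUT «D2γ», bus
2026-08-27 23:16Z).  `--kind proof --supports stmt-QuantumFields-20541 --as helper`.  [6] = [Balaban1985RegularSpaces]; [4] = [Balaban1985BackgroundPropagators];
[B6] = [Balaban1984PropagatorsII]; [I] = [Balaban1987RG1].

WHAT THIS FILE PROVES (theorems only; 0 `def`; nothing of Bałaban asserted).
★★ `prop6MemberB8At_of_sockγ` — V18 stub 2's BODY `∃ B₁ c₁, 0 ≤ B₁ ∧ 0 < c₁ ∧ (letI : CStarAlgebra (MatA 2) := {}; B8.Prop6Printed 4 L B₁ c₁ (zdCub (MatA 2) F.L ·))`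
at the family `F` FROM: constants `B₀ > 0` with `2 ≤ 5·4·L·B₀`, `B₀′ > 0`, `c_P, c_{B9} > 0`, `0 ≤ B_∂`, `4B_∂ ≤ (4L − 1)B₀`, and AT EVERY CUBE `c : CubeB8 4 F.L i.k i.Ω` OF
EVERY MEMBER `i : ZdIdx 4 F.L` the three sockets of the cube road in edition γ at the cube's own member `(i.η, c.k, {□_j}, Λ′)` — [6] Prop. 5's ∃ base ∕ ∃ step
(`SockP5base`, `SockP5`) and `∀ m ≤ c.k`, the four-line collar socket `SockB9P3D4β … m {□_j} Λ′ (cubeLamBP' …)` ([4] Thm 3.3 with exterior data, averaging datum over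
print's class [B6] (2.3)).  Witness `B₁ := 5·4·L·B₀`, `c₁` = the threshold of this seat's `B8Prop6CubeMemberGaugedGamma.prop6Printed_zdCub_of_sockD4γ` at `𝔸 := M₂(ℂ)`,
`d := 4`, `f := id`, through the door `K0Stub2OfPrintedZdCub.prop6MemberB8At_of_prop6Printed` (p584116).
★ `record13SepCoPHBody_of_stub1_sockγ_stub3A` — K0⁷'s body on EVERY family from stub 1, the γ socket families (with their constants) at every `F`, and stub 3ᴬ (Cʷ″ ∘ the above).

HONEST SCOPE ∕ A6 (director-ym №189 (3)).  K0-side SOCKET by name.  The three socket families are DISPLAYED HYPOTHESES: Prop. 5's two ∃ sockets have NO cube-member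
provider in the tree tonight (N05's Prop.-5 lane); the four-line family over `cubeLamBP'` is served from `B9.Thm33Printed` + six member-local binders by dag-n06-b's
`B9SupplySockB9P3ZdGamma.sockB9P3D4γ_allLevels_of_thm33_on` (A6-witnessed at truncation `0` only; `m ≥ 1` = N06's object layer) — the junction knit «D3γ» that feeds it
here is the n05-e successor's (or a later file of this seat); the β-shape sockets are FALSE below an absolute `B₀` threshold (declared in every β∕γ file; the supplier's
constant absorbs it); no joint-satisfiability claim.  LOCATED-CARRIER (dag-n05-e; k0-s2-w2 `K0Stub2DatumForm` p584299): the sockets are asked at EVERY `CubeB8` cube's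
member — collars `ρ = L` included, beyond print's p. 98 cubes — exactly as the K0 consumer `gauge152R_of_prop6` reads them.  Kernel floor met: `B₁ = 20·L·B₀ > 0`.
Stub 2 ∕ N05 ∕ K0⁷ NOT discharged; counts unmoved (typed 28∕28 · discharged 5∕27); one finite 𝕋⁴ programme at fixed `ε = L^{−K}`, Bałaban AS PRINTED — NOT continuum ∕
ℝ⁴ ∕ OS ∕ mass gap ∕ Clay: the Yang–Mills mass gap is NOT proved by any of this; route R4 closes the CONDITIONAL finite-𝕋⁴ rung `BalabanLadder.UV` only.
No `sorry`, `def`, `instance`, `notation`; standard axioms; default heartbeats.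
-/

noncomputable section

open scoped Matrix.Norms.L2Operator

namespace Summit.QuantumFields.YangMills.Theorems.K0Stub2OfSockGamma

open Literature.MathematicalPhysics.QuantumFieldTheory.Balaban1983to89
open Literature.MathematicalPhysics.QuantumFieldTheory.Balaban1983to89.Node00
open Literature.MathematicalPhysics.QuantumFieldTheory.Balaban1983to89.T4Continuum
open Literature.MathematicalPhysics.QuantumFieldTheory.Balaban1983to89.FlowStep
open Literature.MathematicalPhysics.QuantumFieldTheory.Balaban1983to89.B8LeafModelZd (ZdIdx SockP5base SockP5)
open Literature.MathematicalPhysics.QuantumFieldTheory.Balaban1983to89.B7Prop2Explicit (unitaryUnits)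
open Literature.MathematicalPhysics.QuantumFieldTheory.Balaban1983to89.B8Eq131CubesAdmissible (cubeFam)
open Literature.MathematicalPhysics.QuantumFieldTheory.Balaban1983to89.B9SupplySockB9P3ZdBeta (SockB9P3D4β)
open Literature.MathematicalPhysics.QuantumFieldTheory.Balaban1983to89.B8Prop6CubeMemberGaugedGamma (prop6Printed_zdCub_of_sockD4γ)
open Literature.MathematicalPhysics.QuantumFieldTheory.Balaban1983to89.B8Prop6CubeMemberOfThm33Gamma (prop6Printed_zdCub_of_thm33γ₃)
open Literature.MathematicalPhysics.QuantumFieldTheory.Balaban1983to89.B9SupplySockB9P3ZdLetters (OpsZd)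
open Literature.MathematicalPhysics.QuantumFieldTheory.Balaban1983to89.B9SupplySockB9P3ZdAt (DictAt Prop6At InvAt CurvAt LandauAt)
open Literature.MathematicalPhysics.QuantumFieldTheory.Balaban1983to89.B9SupplySockB9P3ZdGamma (cubeLamBP' AvgAtγ)
open Literature.MathematicalPhysics.QuantumFieldTheory.Balaban1983to89.B8CubeMemberZd (cubeLamS cubeLamB)
open Summit.QuantumFields.YangMills.Theorems.K0AllTorusOfStepTokensRCube (record13SepCoPHBody_of_stubs123A)
open Summit.QuantumFields.YangMills.Theorems.K0Stub2OfPrintedZdCub (prop6MemberB8At_of_prop6Printed)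

variable (F : T4Family)

/-- **★★ V18 STUB 2's BODY FROM THE EDITION-γ SOCKET FAMILIES AT EVERY CUBE OF EVERY MEMBER OF `ZdIdx 4 F.L`** ([6] Prop. 6 at NODE 00's `ℤ⁴ × M₂(ℂ)` cube member):
given `B₀ > 0` with `2 ≤ 5·4·L·B₀` (Theorem 4's logarithm device), `B₀′, c_P, c_{B9} > 0`, `0 ≤ B_∂`, `4B_∂ ≤ (4L − 1)B₀`, and — at every cube `c` of every member `i` —
[6] Prop. 5's two EXISTENCE sockets at `(B₀, B₀′, c_P)` and the all-levels four-line collar socket over print's split class `cubeLamBP'` at `(B₀, B_∂, c_{B9})`, the body holds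
with `B₁ := 5·4·L·B₀` and the threshold `c₁(4, L, B₀, B₀′, c_P, c_{B9}, B_∂)` of `prop6Printed_zdCub_of_sockD4γ` (read at `𝔸 := M₂(ℂ)`, `f := id`).
[cite: Balaban1985RegularSpaces, Prop. 6 (1.135)–(1.138) p.99, Thm 4 p.88, Prop. 3 p.87, Prop. 5 (1.107)–(1.108) p.94, (1.59) p.86, (1.31) p.82; Balaban1985BackgroundPropagators, Thm 3.3 p.399; Balaban1984PropagatorsII, (2.3) p.224] -/
theorem prop6MemberB8At_of_sockγ {B₀ B₀' cP cB9 Bbd : ℝ} (hB₀ : 0 < B₀) (hB : 2 ≤ 5 * ((4 : ℕ) : ℝ) * F.L * B₀) (hB₀' : 0 < B₀')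
    (hcP : 0 < cP) (hcB9 : 0 < cB9) (hBbd : 0 ≤ Bbd) (hBd : 4 * Bbd ≤ (((4 : ℕ) : ℝ) * F.L - 1) * B₀)
    (S : letI : CStarAlgebra (MatA 2) := {};
      ∀ (i : ZdIdx 4 F.L) (c : CubeB8 4 F.L i.k i.Ω),
        SockP5base (𝔸 := MatA 2) F.L B₀ B₀' cP i.η c.k (cubeFam false F.L c.a c.M c.ρ c.k) (cubeLamS F.L c.a c.M c.ρ c.k) ∧
        SockP5 (𝔸 := MatA 2) F.L B₀ B₀' cP i.η c.k (cubeFam false F.L c.a c.M c.ρ c.k) (cubeLamS F.L c.a c.M c.ρ c.k) ∧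
        (∀ m, m ≤ c.k → SockB9P3D4β (𝔸 := MatA 2) F.L B₀ Bbd cB9 i.η m (cubeFam false F.L c.a c.M c.ρ c.k) (cubeLamS F.L c.a c.M c.ρ c.k)
          (cubeLamBP' F.L c.a c.M c.ρ c.k))) :
    ∃ B₁ c₁ : ℝ, 0 ≤ B₁ ∧ 0 < c₁ ∧
      (letI : CStarAlgebra (MatA 2) := {}; B8.Prop6Printed 4 (F.L : ℝ) B₁ c₁ (fun i : ZdIdx 4 F.L => zdCub (MatA 2) F.L i)) := by
  letI : CStarAlgebra (MatA 2) := {}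
  have hL : 2 ≤ F.L := by have := F.hL11; omega
  obtain ⟨c₁, hc₁, G⟩ := prop6Printed_zdCub_of_sockD4γ (𝔸 := MatA 2) (d := 4) (by norm_num) hL hB₀ hB hB₀' hcP hcB9 hBbd hBd
  have hL0 : (0 : ℝ) ≤ (F.L : ℝ) := Nat.cast_nonneg _
  exact prop6MemberB8At_of_prop6Printed F (by positivity) hc₁ (G (fun i => i) fun j c => S j c)


/-- **★★★ V18 STUB 2's BODY FROM [4] THEOREM 3.3 BY NAME, EDITION γ — the K0 END of the N06→N05 junction of the cube road** (plan W-SEAT-START-LIST §k0-s2 «the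
THM-3.3 road: `Prop6MemberB8At F` from N06's [B9] Thm 3.3 socks at the ℤᵈ carrier»).  DISPLAYED: a [4] frame `(geo, bg, GA)` with the member readings `mem ∕ ιCfg ∕ ιLoc ∕ ops`
of the `ℤ⁴ × M₂(ℂ)` data, `h33 : B9.Thm33Printed c35 geo bg Gp GA` (N06's node, BY NAME), dag-n06-b's six member-local binders in edition γ (`DictAt`, `Prop6At`, `InvAt`,
`CurvAt`, `LandauAt`, `AvgAtγ` at `cubeLamBP'`) on the datum-carrying cube sub-family of `ZdIdx 4 F.L`, the constants' signs; THEN `∃ B₀ˢ ≥ 1` such that for all `B₀′, c_P > 0`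
and Proposition 5's two EXISTENCE sockets at `B₀ˢ` at every cube datum, the stub-2 body holds (`B₁ = 20·L·B₀ˢ`).  = this seat's `prop6Printed_zdCub_of_thm33γ₃` at
`𝔸 := M₂(ℂ)`, `d := 4`, `f := id`, through the door `prop6MemberB8At_of_prop6Printed`.  A6: binders inhabited at truncation `0` (dag-n06-b γ witness); `m ≥ 1`, Thm 3.3 and
the Prop-5 sockets NOT witnessed; no joint-satisfiability claim.
[cite: Balaban1985RegularSpaces, Prop. 6 p.99, Prop. 3 p.87, Thm 4 p.88, Prop. 5 (1.107)–(1.108) p.94, (1.59) p.86, (1.31) p.82; Balaban1985BackgroundPropagators, Thm 3.3 p.399, (3.16) p.393; Balaban1984PropagatorsII, (2.3) p.224] -/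
theorem prop6MemberB8At_of_thm33γ
    {I : Type} (geo : I → B9.Geometry) (bg : I → B9.Backgrounds) (GA : ∀ i, B9.KernelFamily (geo i) (bg i))
    (mem : ℝ → ZdIdx 4 F.L → ℕ → I)
    (ιCfg : letI : CStarAlgebra (MatA 2) := {};
      ∀ (M : ℝ) (i : ZdIdx 4 F.L) (m : ℕ) (U₀ : B7Prop1Explicit.Site 4 → Fin 4 → (MatA 2)ˣ),
        (∀ x κ, U₀ x κ ∈ unitaryUnits (MatA 2)) → (bg (mem M i m)).Cfg)
    (ιLoc : ∀ (M : ℝ) (i : ZdIdx 4 F.L) (m : ℕ), (B7Prop1Explicit.Site 4 → Fin 4 → MatA 2) → (geo (mem M i m)).Loc)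
    (ops : letI : CStarAlgebra (MatA 2) := {}; ℝ → ZdIdx 4 F.L → ℕ → OpsZd 4 (MatA 2)) {c35 c₆ K₆ M₃ a₃ c69 q : ℝ}
    {Gp : ∀ i, B9.KernelFamily (geo i) (bg i)} (h33 : B9.Thm33Printed c35 geo bg Gp GA)
    (hdict : letI : CStarAlgebra (MatA 2) := {};
      ∀ (M : ℝ) (j : {q : ZdIdx 4 F.L × (B7Prop1Explicit.Site 4 × ℕ × ℕ) // F.L ≤ q.2.2.2 ∧ q.2.2.2 ≤ q.2.2.1 ∧ 11 * 4 < q.2.2.1 ∧ F.L ≤ 4 * q.2.2.1 ∧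
          q.1.Ω = cubeFam false F.L q.2.1 q.2.2.1 q.2.2.2 q.1.k ∧ q.1.Λs = cubeLamS F.L q.2.1 q.2.2.1 q.2.2.2 q.1.k ∧ q.1.Λb = cubeLamB F.L q.2.1 q.2.2.1 q.2.2.2 q.1.k})
        (m : ℕ), DictAt geo bg GA F.L mem ιCfg ιLoc ops M j.1.1 m)
    (hP6 : letI : CStarAlgebra (MatA 2) := {};
      ∀ (M : ℝ) (j : {q : ZdIdx 4 F.L × (B7Prop1Explicit.Site 4 × ℕ × ℕ) // F.L ≤ q.2.2.2 ∧ q.2.2.2 ≤ q.2.2.1 ∧ 11 * 4 < q.2.2.1 ∧ F.L ≤ 4 * q.2.2.1 ∧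
          q.1.Ω = cubeFam false F.L q.2.1 q.2.2.1 q.2.2.2 q.1.k ∧ q.1.Λs = cubeLamS F.L q.2.1 q.2.2.1 q.2.2.2 q.1.k ∧ q.1.Λb = cubeLamB F.L q.2.1 q.2.2.1 q.2.2.2 q.1.k})
        (m : ℕ), M₃ ≤ M → Prop6At bg F.L mem ιCfg c35 c₆ K₆ M j.1.1 m)
    (hinv : letI : CStarAlgebra (MatA 2) := {};
      ∀ (M : ℝ) (j : {q : ZdIdx 4 F.L × (B7Prop1Explicit.Site 4 × ℕ × ℕ) // F.L ≤ q.2.2.2 ∧ q.2.2.2 ≤ q.2.2.1 ∧ 11 * 4 < q.2.2.1 ∧ F.L ≤ 4 * q.2.2.1 ∧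
          q.1.Ω = cubeFam false F.L q.2.1 q.2.2.1 q.2.2.2 q.1.k ∧ q.1.Λs = cubeLamS F.L q.2.1 q.2.2.1 q.2.2.2 q.1.k ∧ q.1.Λb = cubeLamB F.L q.2.1 q.2.2.1 q.2.2.2 q.1.k})
        (m : ℕ), M₃ ≤ M → InvAt bg F.L mem ιCfg ops c35 a₃ M j.1.1 m)
    (hcurv : letI : CStarAlgebra (MatA 2) := {};
      ∀ (M : ℝ) (j : {q : ZdIdx 4 F.L × (B7Prop1Explicit.Site 4 × ℕ × ℕ) // F.L ≤ q.2.2.2 ∧ q.2.2.2 ≤ q.2.2.1 ∧ 11 * 4 < q.2.2.1 ∧ F.L ≤ 4 * q.2.2.1 ∧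
          q.1.Ω = cubeFam false F.L q.2.1 q.2.2.1 q.2.2.2 q.1.k ∧ q.1.Λs = cubeLamS F.L q.2.1 q.2.2.1 q.2.2.2 q.1.k ∧ q.1.Λb = cubeLamB F.L q.2.1 q.2.2.1 q.2.2.2 q.1.k})
        (m : ℕ), M₃ ≤ M → CurvAt bg F.L mem ιCfg ops c35 a₃ c69 M j.1.1 m)
    (hlan : letI : CStarAlgebra (MatA 2) := {};
      ∀ (M : ℝ) (j : {q : ZdIdx 4 F.L × (B7Prop1Explicit.Site 4 × ℕ × ℕ) // F.L ≤ q.2.2.2 ∧ q.2.2.2 ≤ q.2.2.1 ∧ 11 * 4 < q.2.2.1 ∧ F.L ≤ 4 * q.2.2.1 ∧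
          q.1.Ω = cubeFam false F.L q.2.1 q.2.2.1 q.2.2.2 q.1.k ∧ q.1.Λs = cubeLamS F.L q.2.1 q.2.2.1 q.2.2.2 q.1.k ∧ q.1.Λb = cubeLamB F.L q.2.1 q.2.2.1 q.2.2.2 q.1.k})
        (m : ℕ), M₃ ≤ M → LandauAt bg F.L mem ιCfg ops c35 a₃ M j.1.1 m)
    (havg : letI : CStarAlgebra (MatA 2) := {};
      ∀ (M : ℝ) (j : {q : ZdIdx 4 F.L × (B7Prop1Explicit.Site 4 × ℕ × ℕ) // F.L ≤ q.2.2.2 ∧ q.2.2.2 ≤ q.2.2.1 ∧ 11 * 4 < q.2.2.1 ∧ F.L ≤ 4 * q.2.2.1 ∧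
          q.1.Ω = cubeFam false F.L q.2.1 q.2.2.1 q.2.2.2 q.1.k ∧ q.1.Λs = cubeLamS F.L q.2.1 q.2.2.1 q.2.2.2 q.1.k ∧ q.1.Λb = cubeLamB F.L q.2.1 q.2.2.1 q.2.2.2 q.1.k})
        (m : ℕ), AvgAtγ F.L ops q (cubeLamBP' F.L j.1.2.1 j.1.2.2.1 j.1.2.2.2 j.1.1.k) M j.1.1 m)
    (hc₆ : 0 < c₆) (hK₆ : 0 < K₆) (ha₃ : 0 < a₃) (hc69 : 0 ≤ c69) (hq : 0 ≤ q) :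
    ∃ B₀S : ℝ, 1 ≤ B₀S ∧ ∀ {B₀' cP : ℝ}, 0 < B₀' → 0 < cP →
      (letI : CStarAlgebra (MatA 2) := {};
        ∀ (η : ℝ), 0 < η → ∀ (k : ℕ), 1 ≤ k → ∀ (a : B7Prop1Explicit.Site 4) (M ρ : ℕ), F.L ≤ ρ → ρ ≤ M → 11 * 4 < M → F.L ≤ 4 * M →
          SockP5base (𝔸 := MatA 2) F.L B₀S B₀' cP η k (cubeFam false F.L a M ρ k) (cubeLamS F.L a M ρ k)) →
      (letI : CStarAlgebra (MatA 2) := {};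
        ∀ (η : ℝ), 0 < η → ∀ (k : ℕ), 1 ≤ k → ∀ (a : B7Prop1Explicit.Site 4) (M ρ : ℕ), F.L ≤ ρ → ρ ≤ M → 11 * 4 < M → F.L ≤ 4 * M →
          SockP5 (𝔸 := MatA 2) F.L B₀S B₀' cP η k (cubeFam false F.L a M ρ k) (cubeLamS F.L a M ρ k)) →
      ∃ B₁ c₁ : ℝ, 0 ≤ B₁ ∧ 0 < c₁ ∧
        (letI : CStarAlgebra (MatA 2) := {}; B8.Prop6Printed 4 (F.L : ℝ) B₁ c₁ (fun i : ZdIdx 4 F.L => zdCub (MatA 2) F.L i)) := by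
  letI : CStarAlgebra (MatA 2) := {}
  have hL : 2 ≤ F.L := by have := F.hL11; omega
  obtain ⟨B₀S, hB₀S, H⟩ := prop6Printed_zdCub_of_thm33γ₃ (𝔸 := MatA 2) (d := 4) (by norm_num) hL geo bg GA mem ιCfg ιLoc ops h33
    hdict hP6 hinv hcurv hlan havg hc₆ hK₆ ha₃ hc69 hq
  refine ⟨B₀S, hB₀S, fun hB₀' hcP S5b S5 => ?_⟩
  obtain ⟨c₁, hc₁, G⟩ := H hB₀' hcP S5b S5
  have hL0 : (0 : ℝ) ≤ (F.L : ℝ) := Nat.cast_nonneg _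
  have hB0 : (0 : ℝ) ≤ B₀S := le_trans zero_le_one hB₀S
  exact prop6MemberB8At_of_prop6Printed F (by positivity) hc₁ (G (fun i => i))

/-- **K0⁷'s BODY ON EVERY FAMILY FROM STUB 1, THE EDITION-γ SOCKET FAMILIES (WITH THEIR CONSTANTS) AT EVERY `F`, AND STUB 3ᴬ** — dag-n21-c's Cʷ″
`record13SepCoPHBody_of_stubs123A` with `h2` (= V18 stub 2) supplied by `prop6MemberB8At_of_sockγ`.  Hypothesis form; CONDITIONAL; K0⁷ NOT closed; nothing of Bałaban asserted.
[cite: Balaban1985Variational, Thm 1 (8)–(9) p.279, Prop. 8 p.304; Balaban1985RegularSpaces, Prop. 6 p.99, Prop. 5 p.94, (1.59) p.86; Balaban1988Convergent, Thm 1 p.262; Balaban1987RG1, Thm 1 p.259, §1 p.264] -/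
theorem record13SepCoPHBody_of_stub1_sockγ_stub3A
    (h1 : ∀ F : T4Family, ∃ B₃ a₀ a₁ : ℝ, 2 * (F.L : ℝ) ^ 2 ≤ B₃ ∧ 0 < a₀ ∧ 0 < a₁ ∧
      Prop8RegSepTopStep F 2 (fun ν K Ω => suppDomOfRecord F ν K Ω) B₃ a₀ a₁)
    (h2S : ∀ F : T4Family, ∃ B₀ B₀' cP cB9 Bbd : ℝ, 0 < B₀ ∧ 2 ≤ 5 * ((4 : ℕ) : ℝ) * F.L * B₀ ∧ 0 < B₀' ∧ 0 < cP ∧ 0 < cB9 ∧ 0 ≤ Bbd ∧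
      4 * Bbd ≤ (((4 : ℕ) : ℝ) * F.L - 1) * B₀ ∧
      (letI : CStarAlgebra (MatA 2) := {};
        ∀ (i : ZdIdx 4 F.L) (c : CubeB8 4 F.L i.k i.Ω),
          SockP5base (𝔸 := MatA 2) F.L B₀ B₀' cP i.η c.k (cubeFam false F.L c.a c.M c.ρ c.k) (cubeLamS F.L c.a c.M c.ρ c.k) ∧
          SockP5 (𝔸 := MatA 2) F.L B₀ B₀' cP i.η c.k (cubeFam false F.L c.a c.M c.ρ c.k) (cubeLamS F.L c.a c.M c.ρ c.k) ∧
          (∀ m, m ≤ c.k → SockB9P3D4β (𝔸 := MatA 2) F.L B₀ Bbd cB9 i.η m (cubeFam false F.L c.a c.M c.ρ c.k) (cubeLamS F.L c.a c.M c.ρ c.k)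
            (cubeLamBP' F.L c.a c.M c.ρ c.k))))
    (h3A : ∀ (F : T4Family) (B₃ B₃' a₀ a₁ : ℝ), 2 * (F.L : ℝ) ^ 2 ≤ B₃ → 0 < B₃' → 0 < a₀ → 0 < a₁ →
      VariationalThm1RegSepCoP7M F 2 B₃ a₀ a₁ →
      Gauge9RegSepTopStepR F 2 (fun ν K Ω => suppDomOfRecord F ν K Ω) (F.L ^ 3) ((11 * 4 + 3 * F.L) * F.L) B₃ B₃' a₀ a₁ →
      ∃ γ₀ ε₀ ε₂₉ β' : ℝ, 0 < γ₀ ∧ 0 < ε₀ ∧ 0 < ε₂₉ ∧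
        BetaLowerH (-β') γ₀ (betaOfRecord₁₃ F 2 (theta13OfThm1CCM F 2 3 ε₀ ε₂₉ B₃ B₃' a₀ a₁)) ∧
        BetaUpperH β' γ₀ (betaOfRecord₁₃ F 2 (theta13OfThm1CCM F 2 3 ε₀ ε₂₉ B₃ B₃' a₀ a₁))) :
    ∀ F : T4Family, ∃ θ : Stage13HParams F 2, θ.Provisos₁₃SepCoPH F 2 ∧ (θ.ZhUnity F 2 ∧ θ.SlotsNondegenerate₁₃ F 2) ∧ θ.Admissible F 2 :=
  record13SepCoPHBody_of_stubs123A h1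
    (fun F => by
      obtain ⟨B₀, B₀', cP, cB9, Bbd, hB₀, hB, hB₀', hcP, hcB9, hBbd, hBd, S⟩ := h2S F
      exact prop6MemberB8At_of_sockγ F hB₀ hB hB₀' hcP hcB9 hBbd hBd S)
    h3A

end Summit.QuantumFields.YangMills.Theorems.K0Stub2OfSockGamma

end
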